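import Summits.Langlands.Langlands.Theorems.ExteriorSquareAscentReducibleInducesSquareStubNoPlanesAnalyticIdentity

/-!
# Stub `stub_noPlanesAnalytic` of line `Sketch` for crux stmt-Langlands-18054 — II: the abstract
analytic cores of the `(2,2)` case (six Euler products against six)

(`Summit.Langlands.Langlands.Theses.ExteriorSquareAscent.ReducibleInducesSquare`; serving the glue item
stmt-Langlands-18147 `ReducibleInducesSquareGivenJSAR`.)

The identity of partial Euler products of the `(2,2)` case (Shavali 2026, Prop. 4.2, in the Galois-free
form of card `dual-pair-rankin-selberg-syzygy` of crux stmt-Langlands-18054),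

  `L(π × π^∨ ⊗ λ) L(π × π^∨ ⊗ λ²) ζ_K L(λ³) L(Π ⊗ λχ⁻¹)²
    = L(π × (π ⊗ λχ⁻¹)) L(π^∨ × (π^∨ ⊗ χλ²)) L(λ) L(λ²) L(Π ⊗ χ⁻¹) L(Π ⊗ λ²χ⁻¹)`,

is contradictory in two regimes, here proved for ABSTRACT slots (partial `L`-functions of Satake families
with prescribed analytic behaviour), the automorphic data entering only in the next files:

* `false_of_twoTwo_eulerIdentity_of_poles` — ON the unitary axis: the slots on the left have at `s = 1`
  poles of orders `k₁, k₂ ≤ 1`, `1` (Hecke), `k₄ ≤ 1`, `0`, `0` with NON-ZERO leading coefficients, those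
  on the right are finite except for a pole of order `k_d ≤ k₂` in the fourth slot (`λ² = 1 ⇒ π ⊗ λ² ≅ π`);
  multiplying by `(s - 1)^{k₁ + k₂ + k₄ + 1}` gives `c ≠ 0` on the left and `0` on the right;
* `false_of_twoTwo_eulerIdentity_of_shift` — OFF the axis: with all eleven twists shifted INTO `Re s > 1`
  by positive multiples of `t > 0`, every slot but `ζ_K^S` is continuous (and on the left non-zero) at
  `s = 1`, and Hecke's pole is unmatched.
-/

set_option linter.dupNamespace false -- `Summit.Langlands.Langlands` is the mandated namespace

noncomputable section

namespace Summit.Langlands.Langlands.Cruxes.ReducibleInducesSquare.Sketch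

open Literature.NumberTheory.GaloisRepresentations Literature.NumberTheory.Automorphic
open NumberField IsDedekindDomain Filter Polynomial
open scoped Classical MatrixGroups NumberField Topology

/-! ### The `(2,2)` identity on the unitary axis: pole orders -/

section OnAxis

variable {F : Type} [Field F] [NumberField F]

/-- **The `(2,2)` identity ON the unitary axis is contradictory** (abstract slots).  Twelve Satake-family
pairs over `F` whose Euler factors satisfy, off a finite `T`,
`P₁ P₂ P(1,1) P₄ P₅ P₅ = Pa Pb Pc Pd Pe Pf` (the identity
`L(π × π^∨⊗λ) L(π × π^∨⊗λ²) ζ_F L(λ³) L(Π⊗λχ⁻¹)² = L(π × π⊗λχ⁻¹) L(π^∨ × π^∨⊗χλ²) L(λ) L(λ²) L(Π⊗χ⁻¹) L(Π⊗λ²χ⁻¹)`),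
all twelve Euler products multipliable on `Re s > 1` off every finite `S ⊇ T`, and, as `s → 1⁺` off
every such `S`: `(s - 1)^{kᵢ} Lᵢ → cᵢ ≠ 0` for `i = 1, 2, 4` (`kᵢ ∈ ℕ`; (2.2)/(2.3) for `GL₄ × GL₄`,
resp. `GL₁ × GL₁`), `L₅ → c₅ ≠ 0` ((2.2), `GL₆ × GL₁`), `La, Lb, Lc, Le, Lf` with finite limits ((2.2):
the two `GL₄ × GL₄` pairs on the right are off `X` because `π` is NOT essentially self-dual, `L(λ)`
because `λ ≠ 1`), and `(s - 1)^{k_d} Ld` with a finite limit for some `k_d ≤ k₂` (`λ² = 1` puts BOTH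
`L(λ²)` and `L(π × π^∨ ⊗ λ²)` at a pole).  Then `False`: with `W = (s - 1)^{k₁ + k₂ + k₄ + 1}`,
`W · LHS → c₁ c₂ c₀ c₄ c₅² ≠ 0` (Hecke's pole `(s - 1) ζ_F^S → c₀ ≠ 0`,
`tendsto_sub_one_mul_partialPairL_one_one`) while `W · RHS = (s - 1)^{k₁ + k₄ + (k₂ - k_d)} (s - 1) ⋯ → 0`.
[cite: Shavali2026, Prop. 4.2] [cite: ArthurClozelAMS120, Ch. 3 §2 (2.1)–(2.3)] -/
theorem false_of_twoTwo_eulerIdentity_of_poles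
    (α A₁ A₂ one u₃ B₆ uκ Aa αd Ab u₁ u₂ ue uf : SatakeFamily F) {T : Set (HeightOneSpectrum (𝓞 F))}
    (hT : T.Finite) (hone : ∀ w, one w = {1})
    (hm : ∀ {S : Set (HeightOneSpectrum (𝓞 F))}, S.Finite → T ⊆ S → ∀ s : ℂ, 1 < s.re →
      (Multipliable fun v : {v : HeightOneSpectrum (𝓞 F) // v ∉ S} =>
        ((satakePairPolynomial (α v.1) (A₁ v.1)).eval ((v.1.residueCard : ℂ) ^ (-s)))⁻¹) ∧
      (Multipliable fun v : {v : HeightOneSpectrum (𝓞 F) // v ∉ S} =>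
        ((satakePairPolynomial (α v.1) (A₂ v.1)).eval ((v.1.residueCard : ℂ) ^ (-s)))⁻¹) ∧
      (Multipliable fun v : {v : HeightOneSpectrum (𝓞 F) // v ∉ S} =>
        ((satakePairPolynomial (one v.1) (one v.1)).eval ((v.1.residueCard : ℂ) ^ (-s)))⁻¹) ∧
      (Multipliable fun v : {v : HeightOneSpectrum (𝓞 F) // v ∉ S} =>
        ((satakePairPolynomial (u₃ v.1) (one v.1)).eval ((v.1.residueCard : ℂ) ^ (-s)))⁻¹) ∧
      (Multipliable fun v : {v : HeightOneSpectrum (𝓞 F) // v ∉ S} =>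
        ((satakePairPolynomial (B₆ v.1) (uκ v.1)).eval ((v.1.residueCard : ℂ) ^ (-s)))⁻¹) ∧
      (Multipliable fun v : {v : HeightOneSpectrum (𝓞 F) // v ∉ S} =>
        ((satakePairPolynomial (α v.1) (Aa v.1)).eval ((v.1.residueCard : ℂ) ^ (-s)))⁻¹) ∧
      (Multipliable fun v : {v : HeightOneSpectrum (𝓞 F) // v ∉ S} =>
        ((satakePairPolynomial (αd v.1) (Ab v.1)).eval ((v.1.residueCard : ℂ) ^ (-s)))⁻¹) ∧
      (Multipliable fun v : {v : HeightOneSpectrum (𝓞 F) // v ∉ S} =>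
        ((satakePairPolynomial (u₁ v.1) (one v.1)).eval ((v.1.residueCard : ℂ) ^ (-s)))⁻¹) ∧
      (Multipliable fun v : {v : HeightOneSpectrum (𝓞 F) // v ∉ S} =>
        ((satakePairPolynomial (u₂ v.1) (one v.1)).eval ((v.1.residueCard : ℂ) ^ (-s)))⁻¹) ∧
      (Multipliable fun v : {v : HeightOneSpectrum (𝓞 F) // v ∉ S} =>
        ((satakePairPolynomial (B₆ v.1) (ue v.1)).eval ((v.1.residueCard : ℂ) ^ (-s)))⁻¹) ∧
      (Multipliable fun v : {v : HeightOneSpectrum (𝓞 F) // v ∉ S} =>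
        ((satakePairPolynomial (B₆ v.1) (uf v.1)).eval ((v.1.residueCard : ℂ) ^ (-s)))⁻¹))
    (hL₁ : ∀ {S : Set (HeightOneSpectrum (𝓞 F))}, S.Finite → T ⊆ S → ∃ (k : ℕ) (c : ℂ), c ≠ 0 ∧
      Tendsto (fun s => (s - 1) ^ k * partialPairL S α A₁ s) (𝓝[{s : ℂ | 1 < s.re}] 1) (𝓝 c))
    (hL₂d : ∀ {S : Set (HeightOneSpectrum (𝓞 F))}, S.Finite → T ⊆ S →
      ∃ (k kd : ℕ) (c cd : ℂ), c ≠ 0 ∧ kd ≤ k ∧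
        Tendsto (fun s => (s - 1) ^ k * partialPairL S α A₂ s) (𝓝[{s : ℂ | 1 < s.re}] 1) (𝓝 c) ∧
        Tendsto (fun s => (s - 1) ^ kd * partialPairL S u₂ one s) (𝓝[{s : ℂ | 1 < s.re}] 1) (𝓝 cd))
    (hL₄ : ∀ {S : Set (HeightOneSpectrum (𝓞 F))}, S.Finite → T ⊆ S → ∃ (k : ℕ) (c : ℂ), c ≠ 0 ∧
      Tendsto (fun s => (s - 1) ^ k * partialPairL S u₃ one s) (𝓝[{s : ℂ | 1 < s.re}] 1) (𝓝 c))
    (hL₅ : ∀ {S : Set (HeightOneSpectrum (𝓞 F))}, S.Finite → T ⊆ S → ∃ c : ℂ, c ≠ 0 ∧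
      Tendsto (partialPairL S B₆ uκ) (𝓝[{s : ℂ | 1 < s.re}] 1) (𝓝 c))
    (hRa : ∀ {S : Set (HeightOneSpectrum (𝓞 F))}, S.Finite → T ⊆ S → ∃ c : ℂ,
      Tendsto (partialPairL S α Aa) (𝓝[{s : ℂ | 1 < s.re}] 1) (𝓝 c))
    (hRb : ∀ {S : Set (HeightOneSpectrum (𝓞 F))}, S.Finite → T ⊆ S → ∃ c : ℂ,
      Tendsto (partialPairL S αd Ab) (𝓝[{s : ℂ | 1 < s.re}] 1) (𝓝 c))
    (hRc : ∀ {S : Set (HeightOneSpectrum (𝓞 F))}, S.Finite → T ⊆ S → ∃ c : ℂ,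
      Tendsto (partialPairL S u₁ one) (𝓝[{s : ℂ | 1 < s.re}] 1) (𝓝 c))
    (hRe : ∀ {S : Set (HeightOneSpectrum (𝓞 F))}, S.Finite → T ⊆ S → ∃ c : ℂ,
      Tendsto (partialPairL S B₆ ue) (𝓝[{s : ℂ | 1 < s.re}] 1) (𝓝 c))
    (hRf : ∀ {S : Set (HeightOneSpectrum (𝓞 F))}, S.Finite → T ⊆ S → ∃ c : ℂ,
      Tendsto (partialPairL S B₆ uf) (𝓝[{s : ℂ | 1 < s.re}] 1) (𝓝 c))
    (hId : ∀ w ∉ T,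
      satakePairPolynomial (α w) (A₁ w) * satakePairPolynomial (α w) (A₂ w) *
        satakePairPolynomial (one w) (one w) * satakePairPolynomial (u₃ w) (one w) *
        satakePairPolynomial (B₆ w) (uκ w) * satakePairPolynomial (B₆ w) (uκ w) =
      satakePairPolynomial (α w) (Aa w) * satakePairPolynomial (αd w) (Ab w) *
        satakePairPolynomial (u₁ w) (one w) * satakePairPolynomial (u₂ w) (one w) *
        satakePairPolynomial (B₆ w) (ue w) * satakePairPolynomial (B₆ w) (uf w)) :
    False := by
  have hTT : T ⊆ T := le_rfl
  -- the limits of the twelve slots off `T`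
  obtain ⟨k₁, c₁, hc₁, hF₁⟩ := hL₁ hT hTT
  obtain ⟨k₂, kd, c₂, cd, hc₂, hkd, hF₂, hGd⟩ := hL₂d hT hTT
  obtain ⟨j, rfl⟩ := Nat.exists_eq_add_of_le hkd
  obtain ⟨c₀, hc₀, hZ⟩ := tendsto_sub_one_mul_partialPairL_one_one hT hone
  obtain ⟨k₄, c₄, hc₄, hF₄⟩ := hL₄ hT hTT
  obtain ⟨c₅, hc₅, hF₅⟩ := hL₅ hT hTT
  obtain ⟨ca, hGa⟩ := hRa hT hTT
  obtain ⟨cb, hGb⟩ := hRb hT hTT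
  obtain ⟨cc, hGc⟩ := hRc hT hTT
  obtain ⟨ce, hGe⟩ := hRe hT hTT
  obtain ⟨cf, hGf⟩ := hRf hT hTT
  have hsub := tendsto_sub_one_nhdsWithin_one_lt_re
  -- (L-eq) on `Re s > 1`
  have hEq : ∀ᶠ s in 𝓝[{s : ℂ | 1 < s.re}] 1,
      partialPairL T α A₁ s * partialPairL T α A₂ s * partialPairL T one one s *
          partialPairL T u₃ one s * partialPairL T B₆ uκ s * partialPairL T B₆ uκ s =
        partialPairL T α Aa s * partialPairL T αd Ab s * partialPairL T u₁ one s *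
          partialPairL T u₂ one s * partialPairL T B₆ ue s * partialPairL T B₆ uf s := by
    refine eventually_nhdsWithin_of_forall fun s hs => ?_
    obtain ⟨m₁, m₂, m₃, m₄, m₅, ma, mb, mc, md, me, mf⟩ := hm hT hTT s hs
    exact partialPairL_prod_six_eq_of_satakePairPolynomial hId m₁ m₂ m₃ m₄ m₅ m₅ ma mb mc md me mf
  -- the weight `W = (s - 1)^{k₁ + k₂ + k₄ + 1}`
  refine false_of_weighted_identity (W := fun s => (s - 1) ^ (k₁ + (kd + j) + k₄ + 1)) hEq
    (c := c₁ * c₂ * c₀ * c₄ * c₅ * c₅) ?_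
    (mul_ne_zero (mul_ne_zero (mul_ne_zero (mul_ne_zero (mul_ne_zero hc₁ hc₂) hc₀) hc₄) hc₅) hc₅) ?_
  · have h := ((((hF₁.mul hF₂).mul hZ).mul hF₄).mul hF₅).mul hF₅
    refine h.congr fun s => ?_
    ring
  · have h := ((hsub.pow (k₁ + k₄ + j)).mul hsub).mul
      (((((hGa.mul hGb).mul hGc).mul hGd).mul hGe).mul hGf)
    rw [mul_zero, zero_mul] at h
    refine h.congr fun s => ?_
    ring

end OnAxis

/-! ### The `(2,2)` identity off the unitary axis: absolute convergence against Hecke's pole -/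

section OffAxis

variable {F : Type} [Field F] [NumberField F]

/-- Shifting no family: `γ w = q_w^{0} γ w`. [folklore] -/
theorem np_shift_zero {S : Set (HeightOneSpectrum (𝓞 F))} (γ : SatakeFamily F) :
    ∀ w ∉ S, γ w = (γ w).map (((w.residueCard : ℂ) ^ (0 : ℂ)) * ·) := fun w _ => by
  simp only [Complex.cpow_zero, one_mul, Multiset.map_id']

/-- `Re (s - (0 + r)) = Re s - r` for real `r`. [folklore] -/
theorem np_re_sub_zero_add (s : ℂ) (r : ℝ) : (s - (0 + ((r : ℝ) : ℂ))).re = s.re - r := by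
  simp only [Complex.sub_re, Complex.ofReal_re, zero_add]

/-- `Re (s - (r + 0)) = Re s - r` for real `r`. [folklore] -/
theorem np_re_sub_add_zero (s : ℂ) (r : ℝ) : (s - (((r : ℝ) : ℂ) + 0)).re = s.re - r := by
  simp only [Complex.sub_re, Complex.ofReal_re, add_zero]

/-- **The `(2,2)` identity OFF the unitary axis is contradictory** (abstract slots).  Fourteen UNITARY
Satake families as in `false_of_twoTwo_eulerIdentity_of_poles`, whose eleven non-`ζ` pairs have Euler
products multipliable on `Re s > 1` off every finite `S ⊇ T` and partial `L`-functions continuous — and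
for the four slots on the left non-zero — at every point of `Re s > 1` (Jacquet–Shalika I, Thm. 5.3), and
a shift `t > 0` such that off `T`
`P(α, q^{-2t}A₁) P(α, q^{-4t}A₂) P(1,1) P(q^{-6t}u₃, 1) P(B₆, q^{-3t}uκ)² =
 P(α, q^{-3t}Aa) P(αd, q^{-3t}Ab) P(q^{-2t}u₁, 1) P(q^{-4t}u₂, 1) P(B₆, q^{-t}ue) P(B₆, q^{-5t}uf)` —
the `(2,2)` identity in which `|χ(ϖ_v)| = q_v^{t}`, all eleven twists being shifted INTO `Re s > 1`
(`partialPairL_eq_of_shift`).  Then `False`: as `s → 1⁺` every slot but `ζ_F^S` tends to its value at a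
point of `Re s > 1` (non-zero on the left), and Hecke's pole `(s - 1) ζ_F^S(s) → c₀ ≠ 0` is unmatched
(`false_of_weighted_identity` with `W = s - 1`).
[cite: Shavali2026, Prop. 4.2] [cite: JacquetShalikaAJM1981, Thm. (5.3)] -/
theorem false_of_twoTwo_eulerIdentity_of_shift
    (α A₁ A₂ one u₃ B₆ uκ Aa αd Ab u₁ u₂ ue uf : SatakeFamily F) {T : Set (HeightOneSpectrum (𝓞 F))}
    (hT : T.Finite) (hone : ∀ w, one w = {1})
    (hm : ∀ {S : Set (HeightOneSpectrum (𝓞 F))}, S.Finite → T ⊆ S → ∀ s : ℂ, 1 < s.re →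
      (Multipliable fun v : {v : HeightOneSpectrum (𝓞 F) // v ∉ S} =>
        ((satakePairPolynomial (α v.1) (A₁ v.1)).eval ((v.1.residueCard : ℂ) ^ (-s)))⁻¹) ∧
      (Multipliable fun v : {v : HeightOneSpectrum (𝓞 F) // v ∉ S} =>
        ((satakePairPolynomial (α v.1) (A₂ v.1)).eval ((v.1.residueCard : ℂ) ^ (-s)))⁻¹) ∧
      (Multipliable fun v : {v : HeightOneSpectrum (𝓞 F) // v ∉ S} =>
        ((satakePairPolynomial (one v.1) (one v.1)).eval ((v.1.residueCard : ℂ) ^ (-s)))⁻¹) ∧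
      (Multipliable fun v : {v : HeightOneSpectrum (𝓞 F) // v ∉ S} =>
        ((satakePairPolynomial (u₃ v.1) (one v.1)).eval ((v.1.residueCard : ℂ) ^ (-s)))⁻¹) ∧
      (Multipliable fun v : {v : HeightOneSpectrum (𝓞 F) // v ∉ S} =>
        ((satakePairPolynomial (B₆ v.1) (uκ v.1)).eval ((v.1.residueCard : ℂ) ^ (-s)))⁻¹) ∧
      (Multipliable fun v : {v : HeightOneSpectrum (𝓞 F) // v ∉ S} =>
        ((satakePairPolynomial (α v.1) (Aa v.1)).eval ((v.1.residueCard : ℂ) ^ (-s)))⁻¹) ∧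
      (Multipliable fun v : {v : HeightOneSpectrum (𝓞 F) // v ∉ S} =>
        ((satakePairPolynomial (αd v.1) (Ab v.1)).eval ((v.1.residueCard : ℂ) ^ (-s)))⁻¹) ∧
      (Multipliable fun v : {v : HeightOneSpectrum (𝓞 F) // v ∉ S} =>
        ((satakePairPolynomial (u₁ v.1) (one v.1)).eval ((v.1.residueCard : ℂ) ^ (-s)))⁻¹) ∧
      (Multipliable fun v : {v : HeightOneSpectrum (𝓞 F) // v ∉ S} =>
        ((satakePairPolynomial (u₂ v.1) (one v.1)).eval ((v.1.residueCard : ℂ) ^ (-s)))⁻¹) ∧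
      (Multipliable fun v : {v : HeightOneSpectrum (𝓞 F) // v ∉ S} =>
        ((satakePairPolynomial (B₆ v.1) (ue v.1)).eval ((v.1.residueCard : ℂ) ^ (-s)))⁻¹) ∧
      (Multipliable fun v : {v : HeightOneSpectrum (𝓞 F) // v ∉ S} =>
        ((satakePairPolynomial (B₆ v.1) (uf v.1)).eval ((v.1.residueCard : ℂ) ^ (-s)))⁻¹))
    (hc : ∀ {S : Set (HeightOneSpectrum (𝓞 F))}, S.Finite → T ⊆ S → ∀ s : ℂ, 1 < s.re →
      (ContinuousAt (partialPairL S α A₁) s ∧ partialPairL S α A₁ s ≠ 0) ∧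
      (ContinuousAt (partialPairL S α A₂) s ∧ partialPairL S α A₂ s ≠ 0) ∧
      (ContinuousAt (partialPairL S u₃ one) s ∧ partialPairL S u₃ one s ≠ 0) ∧
      (ContinuousAt (partialPairL S B₆ uκ) s ∧ partialPairL S B₆ uκ s ≠ 0) ∧
      ContinuousAt (partialPairL S α Aa) s ∧ ContinuousAt (partialPairL S αd Ab) s ∧
      ContinuousAt (partialPairL S u₁ one) s ∧ ContinuousAt (partialPairL S u₂ one) s ∧
      ContinuousAt (partialPairL S B₆ ue) s ∧ ContinuousAt (partialPairL S B₆ uf) s)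
    {t : ℝ} (ht : 0 < t)
    (hId : ∀ w ∉ T,
      satakePairPolynomial (α w) ((A₁ w).map (((w.residueCard : ℂ) ^ (((-(2 * t) : ℝ)) : ℂ)) * ·)) *
        satakePairPolynomial (α w) ((A₂ w).map (((w.residueCard : ℂ) ^ (((-(4 * t) : ℝ)) : ℂ)) * ·)) *
        satakePairPolynomial (one w) (one w) *
        satakePairPolynomial ((u₃ w).map (((w.residueCard : ℂ) ^ (((-(6 * t) : ℝ)) : ℂ)) * ·)) (one w) *
        satakePairPolynomial (B₆ w) ((uκ w).map (((w.residueCard : ℂ) ^ (((-(3 * t) : ℝ)) : ℂ)) * ·)) *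
        satakePairPolynomial (B₆ w) ((uκ w).map (((w.residueCard : ℂ) ^ (((-(3 * t) : ℝ)) : ℂ)) * ·)) =
      satakePairPolynomial (α w) ((Aa w).map (((w.residueCard : ℂ) ^ (((-(3 * t) : ℝ)) : ℂ)) * ·)) *
        satakePairPolynomial (αd w) ((Ab w).map (((w.residueCard : ℂ) ^ (((-(3 * t) : ℝ)) : ℂ)) * ·)) *
        satakePairPolynomial ((u₁ w).map (((w.residueCard : ℂ) ^ (((-(2 * t) : ℝ)) : ℂ)) * ·)) (one w) *
        satakePairPolynomial ((u₂ w).map (((w.residueCard : ℂ) ^ (((-(4 * t) : ℝ)) : ℂ)) * ·)) (one w) *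
        satakePairPolynomial (B₆ w) ((ue w).map (((w.residueCard : ℂ) ^ (((-t : ℝ)) : ℂ)) * ·)) *
        satakePairPolynomial (B₆ w) ((uf w).map (((w.residueCard : ℂ) ^ (((-(5 * t) : ℝ)) : ℂ)) * ·))) :
    False := by
  have hTT : T ⊆ T := le_rfl
  -- the shifted families
  set sA₁ : SatakeFamily F := fun w => (A₁ w).map (((w.residueCard : ℂ) ^ (((-(2 * t) : ℝ)) : ℂ)) * ·)
  set sA₂ : SatakeFamily F := fun w => (A₂ w).map (((w.residueCard : ℂ) ^ (((-(4 * t) : ℝ)) : ℂ)) * ·)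
  set su₃ : SatakeFamily F := fun w => (u₃ w).map (((w.residueCard : ℂ) ^ (((-(6 * t) : ℝ)) : ℂ)) * ·)
  set suκ : SatakeFamily F := fun w => (uκ w).map (((w.residueCard : ℂ) ^ (((-(3 * t) : ℝ)) : ℂ)) * ·)
  set sAa : SatakeFamily F := fun w => (Aa w).map (((w.residueCard : ℂ) ^ (((-(3 * t) : ℝ)) : ℂ)) * ·)
  set sAb : SatakeFamily F := fun w => (Ab w).map (((w.residueCard : ℂ) ^ (((-(3 * t) : ℝ)) : ℂ)) * ·)
  set su₁ : SatakeFamily F := fun w => (u₁ w).map (((w.residueCard : ℂ) ^ (((-(2 * t) : ℝ)) : ℂ)) * ·)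
  set su₂ : SatakeFamily F := fun w => (u₂ w).map (((w.residueCard : ℂ) ^ (((-(4 * t) : ℝ)) : ℂ)) * ·)
  set sue : SatakeFamily F := fun w => (ue w).map (((w.residueCard : ℂ) ^ (((-t : ℝ)) : ℂ)) * ·)
  set suf : SatakeFamily F := fun w => (uf w).map (((w.residueCard : ℂ) ^ (((-(5 * t) : ℝ)) : ℂ)) * ·)
  have hsA₁ : ∀ w ∉ T, sA₁ w = (A₁ w).map (((w.residueCard : ℂ) ^ (((-(2 * t) : ℝ)) : ℂ)) * ·) :=
    fun w _ => rfl
  have hsA₂ : ∀ w ∉ T, sA₂ w = (A₂ w).map (((w.residueCard : ℂ) ^ (((-(4 * t) : ℝ)) : ℂ)) * ·) :=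
    fun w _ => rfl
  have hsu₃ : ∀ w ∉ T, su₃ w = (u₃ w).map (((w.residueCard : ℂ) ^ (((-(6 * t) : ℝ)) : ℂ)) * ·) :=
    fun w _ => rfl
  have hsuκ : ∀ w ∉ T, suκ w = (uκ w).map (((w.residueCard : ℂ) ^ (((-(3 * t) : ℝ)) : ℂ)) * ·) :=
    fun w _ => rfl
  have hsAa : ∀ w ∉ T, sAa w = (Aa w).map (((w.residueCard : ℂ) ^ (((-(3 * t) : ℝ)) : ℂ)) * ·) :=
    fun w _ => rfl
  have hsAb : ∀ w ∉ T, sAb w = (Ab w).map (((w.residueCard : ℂ) ^ (((-(3 * t) : ℝ)) : ℂ)) * ·) :=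
    fun w _ => rfl
  have hsu₁ : ∀ w ∉ T, su₁ w = (u₁ w).map (((w.residueCard : ℂ) ^ (((-(2 * t) : ℝ)) : ℂ)) * ·) :=
    fun w _ => rfl
  have hsu₂ : ∀ w ∉ T, su₂ w = (u₂ w).map (((w.residueCard : ℂ) ^ (((-(4 * t) : ℝ)) : ℂ)) * ·) :=
    fun w _ => rfl
  have hsue : ∀ w ∉ T, sue w = (ue w).map (((w.residueCard : ℂ) ^ (((-t : ℝ)) : ℂ)) * ·) :=
    fun w _ => rfl
  have hsuf : ∀ w ∉ T, suf w = (uf w).map (((w.residueCard : ℂ) ^ (((-(5 * t) : ℝ)) : ℂ)) * ·) :=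
    fun w _ => rfl
  -- the Euler factors and partial `L`-functions of the shifted pairs are translates
  have e₁ := pairEulerFactor_eq_of_shift (np_shift_zero (S := T) α) hsA₁
  have e₂ := pairEulerFactor_eq_of_shift (np_shift_zero (S := T) α) hsA₂
  have e₄ := pairEulerFactor_eq_of_shift hsu₃ (np_shift_zero (S := T) one)
  have e₅ := pairEulerFactor_eq_of_shift (np_shift_zero (S := T) B₆) hsuκ
  have ea := pairEulerFactor_eq_of_shift (np_shift_zero (S := T) α) hsAa
  have eb := pairEulerFactor_eq_of_shift (np_shift_zero (S := T) αd) hsAb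
  have ec := pairEulerFactor_eq_of_shift hsu₁ (np_shift_zero (S := T) one)
  have ed := pairEulerFactor_eq_of_shift hsu₂ (np_shift_zero (S := T) one)
  have ee := pairEulerFactor_eq_of_shift (np_shift_zero (S := T) B₆) hsue
  have ef := pairEulerFactor_eq_of_shift (np_shift_zero (S := T) B₆) hsuf
  have p₁ := partialPairL_eq_of_shift (np_shift_zero (S := T) α) hsA₁
  have p₂ := partialPairL_eq_of_shift (np_shift_zero (S := T) α) hsA₂
  have p₄ := partialPairL_eq_of_shift hsu₃ (np_shift_zero (S := T) one)
  have p₅ := partialPairL_eq_of_shift (np_shift_zero (S := T) B₆) hsuκ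
  have pa := partialPairL_eq_of_shift (np_shift_zero (S := T) α) hsAa
  have pb := partialPairL_eq_of_shift (np_shift_zero (S := T) αd) hsAb
  have pc := partialPairL_eq_of_shift hsu₁ (np_shift_zero (S := T) one)
  have pd := partialPairL_eq_of_shift hsu₂ (np_shift_zero (S := T) one)
  have pe := partialPairL_eq_of_shift (np_shift_zero (S := T) B₆) hsue
  have pf := partialPairL_eq_of_shift (np_shift_zero (S := T) B₆) hsuf
  -- (2.1): multipliability of the twelve Euler products on `Re s > 1`
  have hEq : ∀ᶠ s in 𝓝[{s : ℂ | 1 < s.re}] 1,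
      partialPairL T α sA₁ s * partialPairL T α sA₂ s * partialPairL T one one s *
          partialPairL T su₃ one s * partialPairL T B₆ suκ s * partialPairL T B₆ suκ s =
        partialPairL T α sAa s * partialPairL T αd sAb s * partialPairL T su₁ one s *
          partialPairL T su₂ one s * partialPairL T B₆ sue s * partialPairL T B₆ suf s := by
    refine eventually_nhdsWithin_of_forall fun s hs => ?_
    have hs' : ∀ r : ℝ, r < 0 → 1 < (s - (0 + ((r : ℝ) : ℂ))).re := fun r hr => by
      rw [np_re_sub_zero_add]; simp only [Set.mem_setOf_eq] at hs; linarith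
    have hs'' : ∀ r : ℝ, r < 0 → 1 < (s - (((r : ℝ) : ℂ) + 0)).re := fun r hr => by
      rw [np_re_sub_add_zero]; simp only [Set.mem_setOf_eq] at hs; linarith
    refine partialPairL_prod_six_eq_of_satakePairPolynomial hId ?_ ?_ (hm hT hTT s hs).2.2.1 ?_ ?_ ?_
      ?_ ?_ ?_ ?_ ?_ ?_
    · rw [e₁ s]; exact (hm hT hTT _ (hs' _ (by linarith))).1
    · rw [e₂ s]; exact (hm hT hTT _ (hs' _ (by linarith))).2.1
    · rw [e₄ s]; exact (hm hT hTT _ (hs'' _ (by linarith))).2.2.2.1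
    · rw [e₅ s]; exact (hm hT hTT _ (hs' _ (by linarith))).2.2.2.2.1
    · rw [e₅ s]; exact (hm hT hTT _ (hs' _ (by linarith))).2.2.2.2.1
    · rw [ea s]; exact (hm hT hTT _ (hs' _ (by linarith))).2.2.2.2.2.1
    · rw [eb s]; exact (hm hT hTT _ (hs' _ (by linarith))).2.2.2.2.2.2.1
    · rw [ec s]; exact (hm hT hTT _ (hs'' _ (by linarith))).2.2.2.2.2.2.2.1
    · rw [ed s]; exact (hm hT hTT _ (hs'' _ (by linarith))).2.2.2.2.2.2.2.2.1
    · rw [ee s]; exact (hm hT hTT _ (hs' _ (by linarith))).2.2.2.2.2.2.2.2.2.1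
    · rw [ef s]; exact (hm hT hTT _ (hs' _ (by linarith))).2.2.2.2.2.2.2.2.2.2
  -- the translation maps along the filter
  have hl : ∀ z : ℂ, Tendsto (fun s : ℂ => s - z) (𝓝[{s : ℂ | 1 < s.re}] 1) (𝓝 (1 - z)) :=
    fun z => ((continuous_id.sub continuous_const).tendsto 1).mono_left nhdsWithin_le_nhds
  have h1' : ∀ r : ℝ, r < 0 → 1 < ((1 : ℂ) - (0 + ((r : ℝ) : ℂ))).re := fun r hr => by
    rw [np_re_sub_zero_add, Complex.one_re]; linarith
  have h1'' : ∀ r : ℝ, r < 0 → 1 < ((1 : ℂ) - (((r : ℝ) : ℂ) + 0)).re := fun r hr => by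
    rw [np_re_sub_add_zero, Complex.one_re]; linarith
  -- the limits of the eleven non-`ζ` slots
  obtain ⟨⟨hc₁, hne₁⟩, -⟩ := hc hT hTT _ (h1' (-(2 * t)) (by linarith))
  have hF₁ : Tendsto (partialPairL T α sA₁) (𝓝[{s : ℂ | 1 < s.re}] 1)
      (𝓝 (partialPairL T α A₁ (1 - (0 + (((-(2 * t) : ℝ)) : ℂ))))) := by
    rw [p₁]; exact hc₁.tendsto.comp (hl _)
  obtain ⟨-, ⟨hc₂, hne₂⟩, -⟩ := hc hT hTT _ (h1' (-(4 * t)) (by linarith))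
  have hF₂ : Tendsto (partialPairL T α sA₂) (𝓝[{s : ℂ | 1 < s.re}] 1)
      (𝓝 (partialPairL T α A₂ (1 - (0 + (((-(4 * t) : ℝ)) : ℂ))))) := by
    rw [p₂]; exact hc₂.tendsto.comp (hl _)
  obtain ⟨c₀, hc₀, hZ⟩ := tendsto_sub_one_mul_partialPairL_one_one hT hone
  obtain ⟨-, -, ⟨hc₄, hne₄⟩, -⟩ := hc hT hTT _ (h1'' (-(6 * t)) (by linarith))
  have hF₄ : Tendsto (partialPairL T su₃ one) (𝓝[{s : ℂ | 1 < s.re}] 1)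
      (𝓝 (partialPairL T u₃ one (1 - ((((-(6 * t) : ℝ)) : ℂ) + 0)))) := by
    rw [p₄]; exact hc₄.tendsto.comp (hl _)
  obtain ⟨-, -, -, ⟨hc₅, hne₅⟩, -⟩ := hc hT hTT _ (h1' (-(3 * t)) (by linarith))
  have hF₅ : Tendsto (partialPairL T B₆ suκ) (𝓝[{s : ℂ | 1 < s.re}] 1)
      (𝓝 (partialPairL T B₆ uκ (1 - (0 + (((-(3 * t) : ℝ)) : ℂ))))) := by
    rw [p₅]; exact hc₅.tendsto.comp (hl _)
  obtain ⟨-, -, -, -, hca, hcb, -⟩ := hc hT hTT _ (h1' (-(3 * t)) (by linarith))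
  have hGa : Tendsto (partialPairL T α sAa) (𝓝[{s : ℂ | 1 < s.re}] 1)
      (𝓝 (partialPairL T α Aa (1 - (0 + (((-(3 * t) : ℝ)) : ℂ))))) := by
    rw [pa]; exact hca.tendsto.comp (hl _)
  have hGb : Tendsto (partialPairL T αd sAb) (𝓝[{s : ℂ | 1 < s.re}] 1)
      (𝓝 (partialPairL T αd Ab (1 - (0 + (((-(3 * t) : ℝ)) : ℂ))))) := by
    rw [pb]; exact hcb.tendsto.comp (hl _)
  obtain ⟨-, -, -, -, -, -, hcc, -⟩ := hc hT hTT _ (h1'' (-(2 * t)) (by linarith))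
  have hGc : Tendsto (partialPairL T su₁ one) (𝓝[{s : ℂ | 1 < s.re}] 1)
      (𝓝 (partialPairL T u₁ one (1 - ((((-(2 * t) : ℝ)) : ℂ) + 0)))) := by
    rw [pc]; exact hcc.tendsto.comp (hl _)
  obtain ⟨-, -, -, -, -, -, -, hcd, -⟩ := hc hT hTT _ (h1'' (-(4 * t)) (by linarith))
  have hGd : Tendsto (partialPairL T su₂ one) (𝓝[{s : ℂ | 1 < s.re}] 1)
      (𝓝 (partialPairL T u₂ one (1 - ((((-(4 * t) : ℝ)) : ℂ) + 0)))) := by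
    rw [pd]; exact hcd.tendsto.comp (hl _)
  obtain ⟨-, -, -, -, -, -, -, -, hce, -⟩ := hc hT hTT _ (h1' (-t) (by linarith))
  have hGe : Tendsto (partialPairL T B₆ sue) (𝓝[{s : ℂ | 1 < s.re}] 1)
      (𝓝 (partialPairL T B₆ ue (1 - (0 + (((-t : ℝ)) : ℂ))))) := by
    rw [pe]; exact hce.tendsto.comp (hl _)
  obtain ⟨-, -, -, -, -, -, -, -, -, hcf⟩ := hc hT hTT _ (h1' (-(5 * t)) (by linarith))
  have hGf : Tendsto (partialPairL T B₆ suf) (𝓝[{s : ℂ | 1 < s.re}] 1)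
      (𝓝 (partialPairL T B₆ uf (1 - (0 + (((-(5 * t) : ℝ)) : ℂ))))) := by
    rw [pf]; exact hcf.tendsto.comp (hl _)
  refine false_of_weighted_identity (W := fun s => s - 1) hEq ?_
    (mul_ne_zero (mul_ne_zero (mul_ne_zero (mul_ne_zero (mul_ne_zero hne₁ hne₂) hc₀) hne₄) hne₅) hne₅) ?_
  · have h := ((((hF₁.mul hF₂).mul hZ).mul hF₄).mul hF₅).mul hF₅
    refine h.congr fun s => ?_
    ring
  · have h := tendsto_sub_one_nhdsWithin_one_lt_re.mul
      (((((hGa.mul hGb).mul hGc).mul hGd).mul hGe).mul hGf)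
    rw [zero_mul] at h
    refine h.congr fun s => ?_
    ring

end OffAxis

end Summit.Langlands.Langlands.Cruxes.ReducibleInducesSquare.Sketch

end
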